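import Summits.HubbardSuperconductivity.HubbardSuperconductivity.Theorems.AnisotropyChordSpinMonotoneDefs
import Summits.HubbardSuperconductivity.HubbardSuperconductivity.Theorems.AnisotropyChordChordToOrderXY
import Summits.HubbardSuperconductivity.HubbardSuperconductivity.Theorems.AnisotropyChordSectorAnchorXY

/-!
# Route `AnisotropyChord`: M_Δ transports the Kennedy–Lieb–Shastry anchor to the attractive side
# (conditional on the typed conjecture `TorusCondensateMonotone`; bears on `FerroSideChord` stmt-19089)

`attractiveSide_halfFilledOrder_of_torusMonotone`: if `TorusCondensateMonotone` (M_Δ, typed in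
`…SpinMonotoneDefs`) holds, then for every `Δ ∈ [0, 1]` every normalised `S^z_tot = 0` sector ground
state of `xxzHamiltonian 1 (torusGraph 2 M) (−1) Δ` on large even tori has planar order `Λ ≥ c·M⁴`,
with the Kennedy–Lieb–Shastry constant of the tree's PROVED anchor `SectorAnchorXY` (stmt-0977,
`sectorAnchorXY_proof`) — half-filled hard-core bosons with nearest-neighbour ATTRACTION, outside every
reflection-positivity window.  This is the theory seat's (`hubbard-h0-rotor-theory-1`) conditional
rung `attractiveSideODLRO_of_monotone` with its KLS input discharged.  CONDITIONAL result: M_Δ is an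
open conjecture.  No definition is introduced.
-/

set_option linter.dupNamespace false

noncomputable section

namespace Summit.HubbardSuperconductivity.HubbardSuperconductivity.Theorems.AnisotropyChord

open Matrix Complex Finset
open Literature.MathematicalPhysics.QuantumLattice Literature.Probability.LatticeModels
open Summit.HubbardSuperconductivity.HubbardSuperconductivity.Theses.AnisotropyChord

/-- **M_Δ transports the Kennedy–Lieb–Shastry anchor to the whole attractive side** (PROVED modulo
M_Δ; the KLS input is the tree's proved `SectorAnchorXY`, stmt-0977): if `TorusCondensateMonotone`
holds then for every `Δ ∈ [0, 1]` there are `c > 0`, `M₀` such that on every even torus of side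
`M ≥ M₀` every normalised `S^z_tot = 0` sector ground state of `xxzHamiltonian 1 (torusGraph 2 M) (−1) Δ`
has planar order `c·M⁴ ≤ Λ(ψ)` — half-filled hard-core bosons with nearest-neighbour ATTRACTION
`V = −Δ ∈ [−1, 0]`, outside every reflection-positivity window.  The constant is the KLS constant at
`Δ = 0`, uniform in `Δ`. [folklore] -/
theorem attractiveSide_halfFilledOrder_of_torusMonotone (h : TorusCondensateMonotone) :
    ∀ Δ ∈ Set.Icc (0 : ℝ) 1, ∃ c : ℝ, 0 < c ∧ ∃ M₀ : ℕ, ∀ (M : ℕ) [NeZero M], Even M → M₀ ≤ M →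
      ∀ ψ : TensorIndex (TorusSite 2 M) 2 → ℂ,
        ψ ∈ spinZSector (Λ := TorusSite 2 M) 1 0 → star ψ ⬝ᵥ ψ = 1 →
        xxzHamiltonian 1 (torusGraph 2 M) (-1) Δ *ᵥ ψ =
          ((lowestEnergyInSector 1 (xxzHamiltonian 1 (torusGraph 2 M) (-1) Δ) 0 : ℝ) : ℂ) • ψ →
        c * (M : ℝ) ^ 4 ≤ (star ψ ⬝ᵥ (((∑ x, onSite x (spinRaise 1)) * (∑ y, onSite y (spinLower 1)) : Op (TorusSite 2 M) 2) *ᵥ ψ)).re := by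
  intro Δ hΔ
  obtain ⟨c, hc, M₀, hA⟩ := sectorAnchorXY_proof
  refine ⟨c, hc, max M₀ 2, fun M _ hM hM₀ ψ gm gn ge => ?_⟩
  have h2 : 2 ≤ M := le_trans (le_max_right _ _) hM₀
  have h0 : M₀ ≤ M := le_trans (le_max_left _ _) hM₀
  obtain ⟨ψ₀, g0m, g0n, g0e⟩ := exists_unit_sectorGroundState_xy M hM h2
  have hanchor := hA M hM h0 ψ₀ g0m g0n g0e
  have hmono := h M 0 0 Δ (by norm_num) hΔ.1 hΔ.2 ψ₀ ψ g0m g0n g0e gm gn ge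
  exact le_trans hanchor hmono

end Summit.HubbardSuperconductivity.HubbardSuperconductivity.Theorems.AnisotropyChord
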